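import Literature.Probability.RandomPlanarGeometry.HexSAWTheorem1
import HarnessLib

/-!
# The density adapter of Kesten's ratio argument on the hexagonal lattice («HEX-RATIO-2», block D-ℍ), generic in the site count `J`

Topic `Literature/Probability/RandomPlanarGeometry`. Lane «pcv-sawmu» bet A2 «HEX-RATIO-2» (lead g8 r58/r64/r65), block D-ℍ,
authored by planner a-idea-1 gen 12 (text eeaf7682), namespace moved to the tree's `SAW.HV` by a-p1 gen 5, filed by a-p4 gen 5.

Port of a-p3's `SAWTriangularDetourAdapter` (p335831) to `ℍ` with the parity indexing of a-p4's ENGINE-ℍ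
(`S m :=` the walks of length `2m+δ`): from the exponential density face of the K1′-ℍ skeleton (d6c6281c,
`DetourDensityHex`, stated here for an ARBITRARY `J : List HV → ℕ` so that it composes with whatever `delCount`
H-BASE fixes) to hypothesis `hP3` of the tree's `SAW.kesten_ineq_of_transfer` with `S m := sawFin hvOrigin (2m+δ)`:
`#{ω ∈ S m : J ω < a m} ≤ C · #S m / m³` (`a = 1/(4Q)`, `C = 27 Q³ max(C₀,0)`), using `μ(ℍ)^N ≤ c_N(ℍ)`
(tree `hexConnectiveConstant_pow_le` + `hexConnectiveConstant_eq_of_thm1 DuminilCopinSmirnov2012_thm1_holds`) and the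
elementary tail `(1/2)^{⌊N/Q⌋} N³ ≤ 27 Q³` (a-p3's lemma, verbatim). [cite: MadrasSlade1993, §7.3 (7.3.9)–(7.3.10)]
-/

noncomputable section

open Finset
open Literature.Probability.LatticeModels Literature.Probability.Percolation SimpleGraph

namespace Literature.Probability.RandomPlanarGeometry.SAW.HV

/-- `(k+1)³ ≤ 27 · 2^k` (a-p3, verbatim). [folklore] -/
private theorem succ_pow_three_le_two_pow : ∀ k : ℕ, (k + 1) ^ 3 ≤ 27 * 2 ^ k
  | 0 => by norm_num
  | 1 => by norm_num
  | 2 => by norm_num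
  | 3 => by norm_num
  | k + 4 => by
    have ih := succ_pow_three_le_two_pow (k + 3)
    have h1 : (k + 4 + 1) ^ 3 ≤ 2 * (k + 3 + 1) ^ 3 := by
      have : (k + 5) ^ 3 ≤ 2 * (k + 4) ^ 3 := by nlinarith [sq_nonneg k, Nat.zero_le k]
      simpa using this
    calc (k + 4 + 1) ^ 3 ≤ 2 * (k + 3 + 1) ^ 3 := h1
      _ ≤ 2 * (27 * 2 ^ (k + 3)) := Nat.mul_le_mul_left 2 ih
      _ = 27 * 2 ^ (k + 4) := by ring

/-- `(1/2)^{⌊N/Q⌋} · N³ ≤ 27 Q³` (a-p3, verbatim). [folklore] -/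
private theorem half_pow_div_mul_cube_le {Q : ℕ} (hQ : 0 < Q) (N : ℕ) :
    (1 / 2 : ℝ) ^ (N / Q) * (N : ℝ) ^ 3 ≤ 27 * (Q : ℝ) ^ 3 := by
  set k := N / Q with hk
  have hN : N ≤ Q * (k + 1) := (Nat.lt_mul_div_succ N hQ).le
  have h1 : (N : ℝ) ^ 3 ≤ ((Q : ℝ) * ((k : ℝ) + 1)) ^ 3 := by
    have : ((N ^ 3 : ℕ) : ℝ) ≤ (((Q * (k + 1)) ^ 3 : ℕ) : ℝ) := by
      exact_mod_cast Nat.pow_le_pow_left hN 3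
    push_cast at this
    exact this
  have h2 : ((k : ℝ) + 1) ^ 3 ≤ 27 * 2 ^ k := by
    exact_mod_cast succ_pow_three_le_two_pow k
  have h3 : (0 : ℝ) < 2 ^ k := by positivity
  rw [one_div_pow, div_mul_eq_mul_div, one_mul, div_le_iff₀ h3, mul_pow] at *
  calc (N : ℝ) ^ 3 ≤ (Q : ℝ) ^ 3 * ((k : ℝ) + 1) ^ 3 := h1
    _ ≤ (Q : ℝ) ^ 3 * (27 * 2 ^ k) := mul_le_mul_of_nonneg_left h2 (by positivity)
    _ = 27 * (Q : ℝ) ^ 3 * 2 ^ k := by ring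

/-- `μ(ℍ)^N = √(2+√2)^N ≤ c_N(ℍ) = #sawFin`. [cite: DuminilCopinSmirnov2012, Thm 1; MadrasSlade1993, §1.2 (1.2.9)–(1.2.10) p. 10] -/
theorem sqrt_pow_le_card_sawFin (N : ℕ) :
    Real.sqrt (2 + Real.sqrt 2) ^ N ≤ (#(sawFin hvOrigin N) : ℝ) := by
  rw [← hexConnectiveConstant_eq_of_thm1 DuminilCopinSmirnov2012_thm1_holds, ← hexSawCount_eq_card]
  exact hexConnectiveConstant_pow_le N

/-- **Block D-ℍ (generic in `J`)**: exponential density of `J`-poor walks ⇒ `hP3` of `kesten_ineq_of_transfer`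
along the parity class `N = 2m+δ`, `S m := sawFin hvOrigin (2m+δ)`.
[cite: MadrasSlade1993, §7.3 (7.3.9)–(7.3.10) (proof of Theorem 7.3.2)] -/
theorem hexKesten_P3_of (J : List HV → ℕ)
    (h : ∃ Q : ℕ, 0 < Q ∧ ∃ C : ℝ, ∀ N : ℕ,
      (({l : List HV | l ∈ sawLists hvGraph hvOrigin N ∧ J l ≤ N / (4 * Q)}.ncard : ℕ) : ℝ) ≤
        C * (1 / 2 : ℝ) ^ (N / Q) * Real.sqrt (2 + Real.sqrt 2) ^ N)
    (δ : ℕ) (hδ : δ ≤ 1) :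
    ∃ a > (0 : ℝ), ∃ C ≥ (0 : ℝ), ∀ m ≥ (1 : ℕ),
      (#((sawFin hvOrigin (2 * m + δ)).filter fun ω => (J ω : ℝ) < a * m) : ℝ) ≤
        C * #(sawFin hvOrigin (2 * m + δ)) / (m : ℝ) ^ 3 := by
  classical
  obtain ⟨Q, hQ, C₀, hC₀⟩ := h
  have hQr : (0 : ℝ) < Q := by exact_mod_cast hQ
  refine ⟨1 / (4 * Q), by positivity, 27 * (Q : ℝ) ^ 3 * max C₀ 0, by positivity, fun m hm => ?_⟩
  set N := 2 * m + δ with hNdef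
  have hmr : (0 : ℝ) < m := by exact_mod_cast hm
  have hmN : m ≤ N := by omega
  have hNr : (0 : ℝ) < N := by exact_mod_cast (show 0 < N by omega)
  -- Step 1: the filter is contained in the density event (threshold `N/(4Q) ≥ m/(4Q)`)
  have hsub : #((sawFin hvOrigin N).filter fun ω => (J ω : ℝ) < 1 / (4 * (Q : ℝ)) * m) ≤
      {l : List HV | l ∈ sawLists hvGraph hvOrigin N ∧ J l ≤ N / (4 * Q)}.ncard := by
    rw [← Set.ncard_coe_finset]
    have hfin : (sawLists hvGraph hvOrigin N).Finite := by
      rw [← coe_sawFin]; exact Finset.finite_toSet _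
    refine Set.ncard_le_ncard ?_ (hfin.subset fun l hl => hl.1)
    intro ω hω
    rw [Finset.coe_filter, Set.mem_setOf_eq, mem_sawFin_iff] at hω
    refine ⟨hω.1, ?_⟩
    rw [Nat.le_div_iff_mul_le (by positivity)]
    have h' := hω.2
    rw [div_mul_eq_mul_div, one_mul, lt_div_iff₀ (by positivity)] at h'
    -- h' : J ω * (4Q) < m ≤ N
    have h'' : ((J ω * (4 * Q) : ℕ) : ℝ) < (N : ℝ) := by
      push_cast
      calc (J ω : ℝ) * (4 * Q) < m := h'
        _ ≤ N := by exact_mod_cast hmN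
    exact_mod_cast h''.le
  -- Step 2: the density bound with `μ^N ≤ #S`
  have hhalf : (0 : ℝ) ≤ (1 / 2 : ℝ) ^ (N / Q) := by positivity
  have hμ : (0 : ℝ) ≤ Real.sqrt (2 + Real.sqrt 2) ^ N := by positivity
  have step2 : (#((sawFin hvOrigin N).filter fun ω => (J ω : ℝ) < 1 / (4 * (Q : ℝ)) * m) : ℝ) ≤
      max C₀ 0 * (1 / 2 : ℝ) ^ (N / Q) * (#(sawFin hvOrigin N) : ℝ) := by
    calc (#((sawFin hvOrigin N).filter fun ω => (J ω : ℝ) < 1 / (4 * (Q : ℝ)) * m) : ℝ)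
        ≤ (({l : List HV | l ∈ sawLists hvGraph hvOrigin N ∧ J l ≤ N / (4 * Q)}.ncard : ℕ) : ℝ) := by
          exact_mod_cast hsub
      _ ≤ C₀ * (1 / 2 : ℝ) ^ (N / Q) * Real.sqrt (2 + Real.sqrt 2) ^ N := hC₀ N
      _ ≤ max C₀ 0 * (1 / 2 : ℝ) ^ (N / Q) * Real.sqrt (2 + Real.sqrt 2) ^ N :=
          mul_le_mul_of_nonneg_right (mul_le_mul_of_nonneg_right (le_max_left _ _) hhalf) hμ
      _ ≤ max C₀ 0 * (1 / 2 : ℝ) ^ (N / Q) * (#(sawFin hvOrigin N) : ℝ) :=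
          mul_le_mul_of_nonneg_left (sqrt_pow_le_card_sawFin N) (mul_nonneg (le_max_right _ _) hhalf)
  -- Step 3: the tail `(1/2)^{⌊N/Q⌋} ≤ 27 Q³ / N³ ≤ 27 Q³ / m³`
  have htail : (1 / 2 : ℝ) ^ (N / Q) ≤ 27 * (Q : ℝ) ^ 3 / (m : ℝ) ^ 3 := by
    have h1 : (1 / 2 : ℝ) ^ (N / Q) ≤ 27 * (Q : ℝ) ^ 3 / (N : ℝ) ^ 3 := by
      rw [le_div_iff₀ (by positivity)]
      exact half_pow_div_mul_cube_le hQ N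
    have h2 : 27 * (Q : ℝ) ^ 3 / (N : ℝ) ^ 3 ≤ 27 * (Q : ℝ) ^ 3 / (m : ℝ) ^ 3 := by
      apply div_le_div_of_nonneg_left (by positivity) (by positivity)
      exact pow_le_pow_left₀ hmr.le (by exact_mod_cast hmN) 3
    exact h1.trans h2
  have hc : (0 : ℝ) ≤ (#(sawFin hvOrigin N) : ℝ) := by positivity
  calc (#((sawFin hvOrigin N).filter fun ω => (J ω : ℝ) < 1 / (4 * (Q : ℝ)) * m) : ℝ)
      ≤ max C₀ 0 * (1 / 2 : ℝ) ^ (N / Q) * (#(sawFin hvOrigin N) : ℝ) := step2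
    _ ≤ max C₀ 0 * (27 * (Q : ℝ) ^ 3 / (m : ℝ) ^ 3) * (#(sawFin hvOrigin N) : ℝ) :=
        mul_le_mul_of_nonneg_right (mul_le_mul_of_nonneg_left htail (le_max_right _ _)) hc
    _ = 27 * (Q : ℝ) ^ 3 * max C₀ 0 * (#(sawFin hvOrigin N) : ℝ) / (m : ℝ) ^ 3 := by
        field_simp

end Literature.Probability.RandomPlanarGeometry.SAW.HV

end
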